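import Summits.QuantumFields.BalabanUV.Beta.FP.LevelZeroDoorSocketCompanion
import Summits.QuantumFields.BalabanUV.Beta.FP.PackedLawFullIndex
import Summits.QuantumFields.BalabanUV.Beta.FP.KktUnitConjugation
import Summits.QuantumFields.BalabanUV.Beta.FP.PackedLegBlocksAtSlices
import Summits.QuantumFields.BalabanUV.Beta.FP.RelInvPeriodisedCombTorusLetters

/-!
# `BalabanUV.Beta.FP.LevelZeroLawFullIndex` — road «FP» for binder row D1, ROUTE T, memo `N2B-DESIGN.md` (34h) STEP 3 ∕ §35: **THE LEVEL-0 (T-ID) LAW ON THE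
# FIBRED TORUS INDICES** — the adapter of record #37c `LevelZeroDoorSocketCompanion` (leaf-02's door I-7 through the socket #36b, STEPS 1+2) COMPOSED WITH
# the assembly socket #39 `PackedLawFullIndex` (STEP 3 (S3-3)), the FINE and COARSE legs DISCHARGED by leaf-05's comb-slice letters (`packedLeg_comb_eq`,
# `kkt_mul_inv_comb`, `perF_rules_comb`, `hId_comb`), the ONE-SHOT leg and the (J-a) namings of the jets DISPLAYED:
# `hessT (perF (fine Lc M′) A_N) V_N V′_N W_N = hessT (perF (fine Lc M′) (GcombSh Lc 0)) V_F V′_F W_F + hessT (perF M′ (GcombSh Lc 1)) V_G V′_G W_G`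

WHY.  JUNCTION J4 (`HOME/b2b-balaban-beta-d1-p3/g26/j4/`) showed that #37c's conclusion IS #39's `hlaw` by ONE term once the legs (S3-1) and the blocks
(S3-2) are displayed equations.  THIS FILE is that composition AS A THEOREM with everything the tree already proves DISCHARGED: the fine system's right
inverse `X_F := (kkt H₀ [Q₁₀;τ₁])⁻¹` and its packed leg (leaf-05's (III′) comb slice at level 0 on `fine Lc M′`, multipliers at `coarsePt`:
`NestedStepLawTorusInstance.coarseSlot_injective ∕ _range`, `dvd_fine`), the coarse system's right inverse by a UNIT CONJUGATION of `(kkt 𝕄₁|ff [Q₂₀;τ₂])⁻¹`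
(`KktUnitConjugation`: the coarse form of the door is `S.toBlocks₁₁ = (wVH 3 Lc 1)⁻¹ • 𝕄₁|ff` — leaf-05 `RelInvPeriodisedCombTorusLetters.hId_comb` — and `kkt (c⁻¹•H) Q =
D_L·kkt H Q·D_R`, so `D_R⁻¹·X·D_L⁻¹` is a right inverse; its packed leg is leaf-05's level-1 comb leg conjugated by `diag(1, c⁻¹)`, `diag(c, 1)`, and by cyclicity
the unit lands on the field blocks of the three jets: `H ↦ c•H` — #40a `KktUnitConjugation`), the torus rules `Ê·Â = Â = Â·Ê` (leaf-05 `perF_rules_comb`).  What stays DISPLAYED is exactly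
the road's remaining letter list at `j = 1`: (L1) the door's rows `hdead a1 a2` per direction and the displayed (bi)linearities (inside #37c's binders);
(S3-1)-N the one-shot leg `hL_N` (an2's (C1) one-shot chart `A_N` + leaf-05 `packedLeg_oneShot_eq`); (S3-2) the jets as full-index torus matrices with their
parities (an2 2d `CombHId2TorusTwin` ∕ 2d-bis `CombHId2TorusTwinSlots` at the record) and the eighteen BLOCK BINDINGS (an2's namings C2a∕b∕c + PART THREE; the
OWNER's #38∕#38b∕#38c pack them at the record).  [folklore] block bookkeeping BY NAME; no `def`, no `def … : Prop`, nothing cited, 0 sorry; 0 estimates.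

HONEST DEPENDENCY (page 1, mandatory): continuum YM on T⁴ ⇐ BetaPertH ∧ nine spine estimates (0/9 proved); BetaPertH ⇐ (D1) ∧ (D4) ∧ CAP+tail;
G-an2-4 gates asym, D1 and NE2/3/4.  HONEST FRAMING (cell contract, verbatim): «discharging `BetaPertH` makes Bałaban's UV stability UNCONDITIONAL —
a real constructive-QFT result; it is NOT the continuum limit and NOT the Clay problem.»  ABSOLUTE RULE (cell charter, verbatim): «No internally-minted
statement may enter as a cited fact. Every hypothesis is either kernel-proved in this package or a verbatim quotation of a PUBLISHED theorem with page
reference. The manuscript(s) under audit are NOT citable for their own disputed steps — they are the thing under adjudication; programme-internal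
(2001/route/tribunal) claims are never citable.»  The door's rows, the one-shot leg and the namings are HYPOTHESES here (nothing of the dictionary ∕ Bałaban's
asserted); 0∕4 row-D1 binders (hW, hR, D1Tel, D1Rep); NOT (T-ID) complete (it is (T-ID) at `j = 1` MODULO the displayed letters), NOT SDF, NOT D1, NOT BetaPertH,
NOT continuum, NOT Clay.  Road «FP» OWNER, b2b-balaban-beta-d1-p3 gen 26, 2026-08-23.  No existing file touched.
-/

noncomputable section

open scoped BigOperators Matrix

namespace Summit.QuantumFields.BalabanUV.Beta.FP.LevelZeroLawFullIndex

open Matrix Finset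
open Literature.Probability.LatticeModels (Torus.proj)
open Literature.MathematicalPhysics.QuantumFieldTheory.Balaban1983to89
open Literature.MathematicalPhysics.QuantumFieldTheory.Balaban1983to89.Beta
open Literature.MathematicalPhysics.QuantumFieldTheory.Balaban1983to89.Beta.Composition (kkt)
open Literature.MathematicalPhysics.QuantumFieldTheory.Balaban1983to89.Beta.CompositionSingular (effForm flucCov minOp minOpL)
open Literature.MathematicalPhysics.QuantumFieldTheory.LatticeForm (quo)
open B5Prop11Plancherel (fine)
open B6Lemma24Torus (pbox mem_pbox)
open AffineAveraging (Site box toSite unitVec)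
open AveragingContoursRooted (ctr ctrOff ctrOff_mem_box)
open SymAveragingHessianCounts (symVhSAt)
open OneStepResolventKernel (Fib KInv)
open InterLevelTransport (SLam)
open BalabanStepJets (lamCoeffOf)
open BalabanStepJetsSucc (wVH)
open Summit.QuantumFields.BalabanUV.Beta.SymAveragingHessianCounts (symHessFFAt)
open Summit.QuantumFields.BalabanUV.Beta.BorderedHessian (bhKStepAt stepScale)
open Summit.QuantumFields.BalabanUV.Beta.DshAn1 (Dsh)
open Summit.QuantumFields.BalabanUV.Beta.SymShiftedSpread (bhKStepSh)
open Summit.QuantumFields.BalabanUV.Beta.D1BFx.LogDetSecondVariation (secondVar)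
open Summit.QuantumFields.BalabanUV.Beta.FP.SecondVarPolarisation (mixedVar)
open Summit.QuantumFields.BalabanUV.Beta.D1BFx.MixedVarPackedHess (hessT)
open Summit.QuantumFields.BalabanUV.Beta.FP.KernelPeriodisationFib (Idx perF)
open Summit.QuantumFields.BalabanUV.Beta.FP.KernelPeriodisationFibLoc (dper)
open Summit.QuantumFields.BalabanUV.Beta.FP.TorusGaugeCovariance (tdelta tgrad)
open Summit.QuantumFields.BalabanUV.Beta.FP.TorusGaugeCovarianceCoarse (coarsePt tgradBlock)
open Summit.QuantumFields.BalabanUV.Beta.FP.TorusCombRows (Res combRowsT combBondT)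
open Summit.QuantumFields.BalabanUV.Beta.FP.TorusCombNestedBasis (resBigEquiv)
open Summit.QuantumFields.BalabanUV.Beta.GAN24.FineReadoutCauchyFrame (toSite_mem_range)
open StepJetData (wilsonA)
open Summit.QuantumFields.BalabanUV.Beta.SymSecondOrderTablesAn1 (symVh₂SAn1)
open ExpKernelCalculus (MKer)
open B4TorusKernel.MultiPeriod (translate)
open WilsonBiStencil (wilsonW₂)
open WilsonVertex2Sym (wsym22)
open Summit.QuantumFields.BalabanUV.Beta.AxialDressingRooted (axEc)
open Summit.QuantumFields.BalabanUV.Beta.CombChartStepJets (GcombSh)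
open Summit.QuantumFields.BalabanUV.Beta.FP.LevelZeroDoorSocketCompanion (hessT_kernel_law_levelZero_companion)
open Summit.QuantumFields.BalabanUV.Beta.FP.PackedLawFullIndex (hessT_fullIndex_law_of_packed_law)
open Summit.QuantumFields.BalabanUV.Beta.FP.KktUnitConjugation (kkt_inv_smul_mul_rightInverse fromBlocks_one_units_eq_diagonal fromBlocks_units_one_eq_diagonal
  submatrix_diagonal_mul_mul_diagonal sumElim_const_comp_map hessT_unitConj)
open Summit.QuantumFields.BalabanUV.Beta.FP.PackedLegBlocksAtSlices (packedLeg_comb_eq kkt_mul_inv_comb)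
open Summit.QuantumFields.BalabanUV.Beta.FP.RelInvPeriodisedComb (perF_rules_comb)
open Summit.QuantumFields.BalabanUV.Beta.FP.RelInvPeriodisedEffFormCoarse (wVH_pos)
open Summit.QuantumFields.BalabanUV.Beta.FP.RelInvPeriodisedCombTorusLetters (hId_comb)
open Summit.QuantumFields.BalabanUV.Beta.FP.NestedStepLawTorusInstance (dvd_fine coarseSlot_injective coarseSlot_range)


/-! ## The level-0 (T-ID) law on the fibred torus indices: #37c ∘ #39, the F and G legs discharged, the N leg and the (J-a) namings displayed -/

section Law

variable (M' : Fin (3 + 1) → ℕ) [∀ μ, NeZero (M' μ)] {Lc : ℕ} [NeZero Lc]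

set_option synthInstance.maxSize 1024 in
set_option maxHeartbeats 3200000 in
/-- [folklore] **`hessT_fullIndex_law_levelZero_companion` — THE LEVEL-0 (T-ID) LAW IN (P2‴)'s CURRENCY, FROM THE DOOR WITH ITS COMPANION PAIR.**  #37c's
binders VERBATIM (I-7's door: direction module `V`, read-outs `hv lv`, tables, companions, rows `hdead a1 a2` per direction, the one-shot right inverse `XN`
with `hXN`) EXCEPT the fine and coarse right inverses, which are CHOSEN here: `X_F := (kkt H₀ [Q₁₀;τ₁])⁻¹` (leaf-05 `kkt_mul_inv_comb` at level 0 on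
`fine Lc M′`) and `X_G :=` the unit conjugate of `(kkt 𝕄₁|ff [Q₂₀;τ₂])⁻¹` (level 1 on `M′`; the coarse form IS `(wVH 3 Lc 1)⁻¹ • 𝕄₁|ff` by leaf-05
`hId_comb`, #40a `KktUnitConjugation.kkt_inv_smul_mul_rightInverse`); PLUS, DISPLAYED: (S3-1) for N only (`hL_N`: the one-shot leg as leaf-06's packed leg over a chart kernel
`A_N` under the torus rules — an2's (C1) one-shot chart + leaf-05 `packedLeg_oneShot_eq`), and (S3-2) for N, F, G: full-index torus matrices `V_X V′_X W_X`
with the parities (μμ-free; symmetric ∕ antisymmetric twin — an2 2d ∕ 2d-bis at the record) and the BLOCK BINDINGS `hH_X₁ … hQ_X₂` (#37c's blocks = the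
restrictions; an2's namings + #38∕#38b∕#38c; the G-blocks carry the unit `wVH 3 Lc 1`).  CONCLUSION:
`hessT (perF (fine Lc M′) A_N) V_N V′_N W_N = hessT (perF (fine Lc M′) (GcombSh Lc 0)) V_F V′_F W_F + hessT (perF M′ (GcombSh Lc 1)) V_G V′_G W_G` —
(P2‴) `hessKer_law_of_torus_hessT_law`'s `hlaw` at this box once `V_X = perF (dper 𝒱_X)` etc.  PROOF: #37c at the chosen inverses; the F leg rewritten by
leaf-05 `packedLeg_comb_eq` (level 0, `fine Lc M′`, multipliers at `coarsePt`), the G leg by `packedLeg_comb_eq` (level 1, `M′`) after #40a's unit transfer;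
then ONE term of #39 `hessT_fullIndex_law_of_packed_law` (torus rules: leaf-05 `perF_rules_comb`; slot facts `coarseSlot_injective ∕ _range`, `dvd_fine`). -/
theorem hessT_fullIndex_law_levelZero_companion
    {κ : Type*} [Fintype κ] [DecidableEq κ]
    -- the direction module and its two DISPLAYED linear read-outs (fine direction `h = hv v`, gauge parameter `λ = lv v`); at the nested layer
    -- `V := σ → ℝ` (top-bond weights) with `hv r := Σ_k r k • col k`, or the comb-dead submodule — leaf-06 g26 W-3
    {V : Type*} [AddCommGroup V] [Module ℝ V]
    (hv : V → (↥(pbox (fine Lc M')) × Fin (3 + 1) → ℝ)) (lv : V → (↥(pbox (fine Lc M')) → ℝ))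
    (hhv : ∀ (c : ℝ) (x y : V), hv (c • x + y) = c • hv x + hv y) (hlv : ∀ (c : ℝ) (x y : V), lv (c • x + y) = c • lv x + lv y)
    (hM' : ∀ i, Lc ∣ M' i)
    (pμ' : κ → ↥(pbox M'))
    (mμ' : κ → Fin (3 + 1))
    (hfμ' : Function.Injective (fun a : κ => ((pμ' a, Sum.inr (mμ' a)) : Idx M' (Fib 3))))
    (hcoarse' : ∀ (s : ↥(pbox M')) (m : Fin (3 + 1)),
      ((s, Sum.inr m) : Idx M' (Fib 3)) ∈ Set.range (fun a : κ => ((pμ' a, Sum.inr (mμ' a)) : Idx M' (Fib 3))) ↔ Torus.proj Lc (s : Site (3 + 1)) = 0)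
    {H₀ : Matrix (↥(pbox (fine Lc M')) × Fin (3 + 1)) (↥(pbox (fine Lc M')) × Fin (3 + 1)) ℝ}
    {Q₁₀ : Matrix (↥(pbox M') × Fin (3 + 1)) (↥(pbox (fine Lc M')) × Fin (3 + 1)) ℝ}
    {τ₁ : Matrix (Res (ctr (3 + 1) Lc) Lc (fine Lc M')) (↥(pbox (fine Lc M')) × Fin (3 + 1)) ℝ}
    {τ₂ : Matrix (Res (ctr (3 + 1) Lc) Lc M') (↥(pbox M') × Fin (3 + 1)) ℝ}
    {D₁ : Matrix (↥(pbox (fine Lc M')) × Fin (3 + 1)) (Res (ctr (3 + 1) Lc) Lc (fine Lc M')) ℝ}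
    {D₂ : Matrix (↥(pbox (fine Lc M')) × Fin (3 + 1)) (Res (ctr (3 + 1) Lc) Lc M') ℝ}
    {Dbar : Matrix (↥(pbox M') × Fin (3 + 1)) (Res (ctr (3 + 1) Lc) Lc M') ℝ}
    {P : Matrix (Res (ctr (3 + 1) Lc) Lc M' ⊕ Res (ctr (3 + 1) Lc) Lc (fine Lc M')) (↥(pbox (fine Lc M')) × Fin (3 + 1)) ℝ}
    (hH₀ : H₀ = (perF (fine Lc M') (bhKStepSh 3 Lc (Dsh Lc) 0)).submatrix
        (fun b : ↥(pbox (fine Lc M')) × Fin (3 + 1) => ((b.1, Sum.inl b.2) : Idx (fine Lc M') (Fib 3)))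
        (fun b : ↥(pbox (fine Lc M')) × Fin (3 + 1) => ((b.1, Sum.inl b.2) : Idx (fine Lc M') (Fib 3))))
    (hQ₁₀ : Q₁₀ = (perF (fine Lc M') (bhKStepSh 3 Lc (Dsh Lc) 0)).submatrix
        (fun a : ↥(pbox M') × Fin (3 + 1) => ((coarsePt M' Lc a.1, Sum.inr a.2) : Idx (fine Lc M') (Fib 3)))
        (fun b : ↥(pbox (fine Lc M')) × Fin (3 + 1) => ((b.1, Sum.inl b.2) : Idx (fine Lc M') (Fib 3))))
    (hτ₁ : τ₁ = (combRowsT (ctr (3 + 1) Lc) Lc (fine Lc M')).submatrix id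
        (fun b : ↥(pbox (fine Lc M')) × Fin (3 + 1) => ((b.1, Sum.inl b.2) : Idx (fine Lc M') (Fib 3))))
    (hτ₂ : τ₂ = (combRowsT (ctr (3 + 1) Lc) Lc M').submatrix id (fun b : ↥(pbox M') × Fin (3 + 1) => ((b.1, Sum.inl b.2) : Idx M' (Fib 3))))
    (hD₁ : D₁ = (tgrad (fine Lc M')).submatrix (fun b : ↥(pbox (fine Lc M')) × Fin (3 + 1) => ((b.1, Sum.inl b.2) : Idx (fine Lc M') (Fib 3)))
        (Subtype.val : Res (ctr (3 + 1) Lc) Lc (fine Lc M') → ↥(pbox (fine Lc M'))))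
    (hD₂ : D₂ = (tgradBlock M' Lc).submatrix (fun b : ↥(pbox (fine Lc M')) × Fin (3 + 1) => ((b.1, Sum.inl b.2) : Idx (fine Lc M') (Fib 3)))
        (Subtype.val : Res (ctr (3 + 1) Lc) Lc M' → ↥(pbox M')))
    (hDbar : Dbar = Matrix.of fun (a : ↥(pbox M') × Fin (3 + 1)) (t : Res (ctr (3 + 1) Lc) Lc M') =>
        stepScale 3 Lc 0 * (((box (3 + 1) Lc).card : ℝ) * tgrad M' (a.1, Sum.inl a.2) t.1))
    (hP : P = (combRowsT ((Lc : ℤ) • ctr (3 + 1) Lc + ctr (3 + 1) Lc) (Lc * Lc) (fine Lc M')).submatrix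
        (resBigEquiv Lc Lc (ctr (3 + 1) Lc) (ctr (3 + 1) Lc) M' (Nat.pos_of_ne_zero (NeZero.ne Lc)) (toSite_mem_range (ctrOff_mem_box (Nat.one_le_iff_ne_zero.mpr (NeZero.ne Lc))))
          (Nat.pos_of_ne_zero (NeZero.ne Lc)) (toSite_mem_range (ctrOff_mem_box (Nat.one_le_iff_ne_zero.mpr (NeZero.ne Lc))))).symm
        (fun b : ↥(pbox (fine Lc M')) × Fin (3 + 1) => ((b.1, Sum.inl b.2) : Idx (fine Lc M') (Fib 3))))
    {Q₂₀ : Matrix κ (↥(pbox M') × Fin (3 + 1)) ℝ}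
    (hQ₂₀ : Q₂₀ = (perF M' (bhKStepSh 3 Lc (Dsh Lc) 1)).submatrix (fun a : κ => ((pμ' a, Sum.inr (mμ' a)) : Idx M' (Fib 3)))
        (fun b : ↥(pbox M') × Fin (3 + 1) => ((b.1, Sum.inl b.2) : Idx M' (Fib 3))))
    (Q₁₁ : (↥(pbox (fine Lc M')) × Fin (3 + 1) → ℝ) → Matrix (↥(pbox M') × Fin (3 + 1)) (↥(pbox (fine Lc M')) × Fin (3 + 1)) ℝ)
    (hQ₁₁ : ∀ w, Q₁₁ w = ∑ b : ↥(pbox (fine Lc M')) × Fin (3 + 1), w b •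
        (perF (fine Lc M') (dper (fine Lc M') (symVhSAt (ctr (3 + 1) Lc) 3 Lc rfl b.2 (b.1 : Site (3 + 1))))).submatrix
          (fun a : ↥(pbox M') × Fin (3 + 1) => ((coarsePt M' Lc a.1, Sum.inr a.2) : Idx (fine Lc M') (Fib 3)))
          (fun b : ↥(pbox (fine Lc M')) × Fin (3 + 1) => ((b.1, Sum.inl b.2) : Idx (fine Lc M') (Fib 3))))
    (Q₂₁ : (↥(pbox (fine Lc M')) × Fin (3 + 1) → ℝ) → Matrix κ (↥(pbox M') × Fin (3 + 1)) ℝ)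
    (hQ₂₁ : ∀ w, Q₂₁ w = ∑ b : ↥(pbox (fine Lc M')) × Fin (3 + 1), w b •
        ∑ a' : ↥(pbox M') × Fin (3 + 1), (stepScale 3 Lc 1 / (stepScale 3 Lc 0 ^ 2 * ((box (3 + 1) Lc).card : ℝ)) * Q₁₀ a' b) •
          (perF M' (dper M' (symVhSAt (ctr (3 + 1) Lc) 3 Lc rfl a'.2 (a'.1 : Site (3 + 1))))).submatrix (fun a : κ => ((pμ' a, Sum.inr (mμ' a)) : Idx M' (Fib 3)))
            (fun b : ↥(pbox M') × Fin (3 + 1) => ((b.1, Sum.inl b.2) : Idx M' (Fib 3))))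
    (w : ℝ)
    (N := Lc)
    (hN : 2 ≤ N)
    {W : Fin (3 + 1) → Site (3 + 1) → Fin (3 + 1) → Site (3 + 1) → MKer (3 + 1) (Fib 3)}
    (hW : W = fun κ' u' κ u x z a c =>
      ∑' n : Site (3 + 1), wilsonW₂ 3 ((8 * (N : ℝ) ^ 2)⁻¹ • wsym22 N) κ u κ' (translate (fine Lc M') u' n) x z a c)
    {W₁₂ : Fin (3 + 1) → Site (3 + 1) → Fin (3 + 1) → Site (3 + 1) → MKer (3 + 1) (Fib 3)}
    (hW₁₂ : W₁₂ = fun κ' u' κ u x z a c => ∑' n : Site (3 + 1), symVh₂SAn1 3 Lc κ u κ' (translate (fine Lc M') u' n) x z a c)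
    (Q₁₂ : (↥(pbox (fine Lc M')) × Fin (3 + 1) → ℝ) → (↥(pbox (fine Lc M')) × Fin (3 + 1) → ℝ) → Matrix (↥(pbox M') × Fin (3 + 1)) (↥(pbox (fine Lc M')) × Fin (3 + 1)) ℝ)
    (hQ₁₂ : ∀ w w', Q₁₂ w w' = -(((Lc : ℝ) ^ (3 + 1) * stepScale 3 Lc 0)⁻¹) • ∑ b : ↥(pbox (fine Lc M')) × Fin (3 + 1), ∑ b' : ↥(pbox (fine Lc M')) × Fin (3 + 1), (w b * w' b') •
        (perF (fine Lc M') (dper (fine Lc M') (W₁₂ b'.2 (b'.1 : Site (3 + 1)) b.2 (b.1 : Site (3 + 1))))).submatrix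
          (fun a : ↥(pbox M') × Fin (3 + 1) => ((coarsePt M' Lc a.1, Sum.inr a.2) : Idx (fine Lc M') (Fib 3)))
          (fun c : ↥(pbox (fine Lc M')) × Fin (3 + 1) => ((c.1, Sum.inl c.2) : Idx (fine Lc M') (Fib 3))))
    {W₂₂ : Fin (3 + 1) → Site (3 + 1) → Fin (3 + 1) → Site (3 + 1) → MKer (3 + 1) (Fib 3)}
    (hW₂₂ : W₂₂ = fun κ' u' κ u x z a c => ∑' n : Site (3 + 1), symVh₂SAn1 3 Lc κ u κ' (translate M' u' n) x z a c)
    (Q₂₂ : (↥(pbox (fine Lc M')) × Fin (3 + 1) → ℝ) → (↥(pbox (fine Lc M')) × Fin (3 + 1) → ℝ) → Matrix κ (↥(pbox M') × Fin (3 + 1)) ℝ)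
    (hQ₂₂ : ∀ w w', Q₂₂ w w' = -(((Lc : ℝ) ^ (3 + 1) * stepScale 3 Lc 1)⁻¹) • (∑ a' : ↥(pbox M') × Fin (3 + 1), ∑ a'' : ↥(pbox M') × Fin (3 + 1),
          (((stepScale 3 Lc 1 / (stepScale 3 Lc 0 ^ 2 * ((box (3 + 1) Lc).card : ℝ))) * ∑ b : ↥(pbox (fine Lc M')) × Fin (3 + 1), Q₁₀ a' b * w b) * ((stepScale 3 Lc 1 / (stepScale 3 Lc 0 ^ 2 * ((box (3 + 1) Lc).card : ℝ))) * ∑ b : ↥(pbox (fine Lc M')) × Fin (3 + 1), Q₁₀ a'' b * w' b)) •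
            (perF M' (dper M' (W₂₂ a''.2 (a''.1 : Site (3 + 1)) a'.2 (a'.1 : Site (3 + 1))))).submatrix (fun a : κ => ((pμ' a, Sum.inr (mμ' a)) : Idx M' (Fib 3)))
            (fun b : ↥(pbox M') × Fin (3 + 1) => ((b.1, Sum.inl b.2) : Idx M' (Fib 3)))))
    {Γ : Matrix (↥(pbox (fine Lc M')) × Fin (3 + 1)) (↥(pbox (fine Lc M')) × Fin (3 + 1)) ℝ}
    {I : Matrix (↥(pbox (fine Lc M')) × Fin (3 + 1)) ((↥(pbox M') × Fin (3 + 1)) ⊕ Res (ctr (3 + 1) Lc) Lc (fine Lc M')) ℝ}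
    {L : Matrix ((↥(pbox M') × Fin (3 + 1)) ⊕ Res (ctr (3 + 1) Lc) Lc (fine Lc M')) (↥(pbox (fine Lc M')) × Fin (3 + 1)) ℝ}
    {S : Matrix ((↥(pbox M') × Fin (3 + 1)) ⊕ Res (ctr (3 + 1) Lc) Lc (fine Lc M')) ((↥(pbox M') × Fin (3 + 1)) ⊕ Res (ctr (3 + 1) Lc) Lc (fine Lc M')) ℝ}
    (hΓ : flucCov H₀ (fromRows Q₁₀ τ₁) = Γ)
    (hI : minOp H₀ (fromRows Q₁₀ τ₁) = I)
    (hL : minOpL H₀ (fromRows Q₁₀ τ₁) = L)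
    (hS : effForm H₀ (fromRows Q₁₀ τ₁) = S)

    {𝔔₀ : Matrix κ (↥(pbox (fine Lc M')) × Fin (3 + 1)) ℝ} (h𝔔₀ : Q₂₀ * Q₁₀ = 𝔔₀)
    -- I-7's direction-dependent generator jets as FUNCTIONS of the direction `v` (I-7's `hW₁ hDb₁ hW₂ hH₁ hH₂ hH'₁ hH'₂` right-hand sides VERBATIM, `G` taken out)
    (W₁f : V → Matrix (↥(pbox (fine Lc M')) × Fin (3 + 1)) (Res (ctr (3 + 1) Lc) Lc M' ⊕ Res (ctr (3 + 1) Lc) Lc (fine Lc M')) ℝ)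
    (hW₁f : ∀ v, W₁f v = ∑ b : ↥(pbox (fine Lc M')) × Fin (3 + 1), (hv v) b •
        Matrix.of (fun (b' : ↥(pbox (fine Lc M')) × Fin (3 + 1)) (e : Res (ctr (3 + 1) Lc) Lc M' ⊕ Res (ctr (3 + 1) Lc) Lc (fine Lc M')) =>
          if b' = b then
            -((((Lc : ℝ) ^ (3 + 1) * stepScale 3 Lc 0)⁻¹)
              * Sum.elim (fun t : Res (ctr (3 + 1) Lc) Lc M' => tdelta M' (quo Lc ((b.1 : Site (3 + 1)) + unitVec b.2)) t.1)
                  (fun s : Res (ctr (3 + 1) Lc) Lc (fine Lc M') => tdelta (fine Lc M') ((b.1 : Site (3 + 1)) + unitVec b.2) s.1) e)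
          else 0))
    (Db₁f : V → Matrix (↥(pbox M') × Fin (3 + 1)) (Res (ctr (3 + 1) Lc) Lc M') ℝ)
    (hDb₁f : ∀ v, Db₁f v = ∑ b : ↥(pbox (fine Lc M')) × Fin (3 + 1), (hv v) b •
        Matrix.of fun (a : ↥(pbox M') × Fin (3 + 1)) (t : Res (ctr (3 + 1) Lc) Lc M') =>
          -((((Lc : ℝ) ^ (3 + 1) * stepScale 3 Lc 0)⁻¹) * Q₁₀ a b * tdelta M' ((a.1 : Site (3 + 1)) + unitVec a.2) t.1))
    (W₂f : V → Matrix (↥(pbox (fine Lc M')) × Fin (3 + 1)) (Res (ctr (3 + 1) Lc) Lc M' ⊕ Res (ctr (3 + 1) Lc) Lc (fine Lc M')) ℝ)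
    (hW₂f : ∀ v, W₂f v = Matrix.of fun (b : ↥(pbox (fine Lc M')) × Fin (3 + 1)) (e : Res (ctr (3 + 1) Lc) Lc M' ⊕ Res (ctr (3 + 1) Lc) Lc (fine Lc M')) =>
        ((((Lc : ℝ) ^ (3 + 1) * stepScale 3 Lc 0)⁻¹) * (hv v) b) ^ 2 * Sum.elim (fun t : Res (ctr (3 + 1) Lc) Lc M' => tdelta M' (quo Lc ((b.1 : Site (3 + 1)) + unitVec b.2)) t.1)
          (fun s : Res (ctr (3 + 1) Lc) Lc (fine Lc M') => tdelta (fine Lc M') ((b.1 : Site (3 + 1)) + unitVec b.2) s.1) e)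
    (H₁f : V → Matrix (↥(pbox (fine Lc M')) × Fin (3 + 1)) (↥(pbox (fine Lc M')) × Fin (3 + 1)) ℝ)
    (hH₁f : ∀ v, H₁f v = ((-2 : ℝ) * (((Lc : ℝ) ^ (3 + 1) * stepScale 3 Lc 0)⁻¹)) • (∑ b : ↥(pbox (fine Lc M')) × Fin (3 + 1), (hv v) b •
        (perF (fine Lc M') (dper (fine Lc M') (wilsonA 3 b.2 (b.1 : Site (3 + 1))))).submatrix
          (fun b : ↥(pbox (fine Lc M')) × Fin (3 + 1) => ((b.1, Sum.inl b.2) : Idx (fine Lc M') (Fib 3)))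
          (fun b : ↥(pbox (fine Lc M')) × Fin (3 + 1) => ((b.1, Sum.inl b.2) : Idx (fine Lc M') (Fib 3))))
      + ∑ b : ↥(pbox (fine Lc M')) × Fin (3 + 1), (hv v) b •
        (w • (perF (fine Lc M') (dper (fine Lc M')
            (SLam Lc (lamCoeffOf (KInv (N := Lc) (d := 3)) Lc) (symHessFFAt (ctr (3 + 1) Lc) Lc) b.2 (b.1 : Site (3 + 1))))).submatrix
          (fun b : ↥(pbox (fine Lc M')) × Fin (3 + 1) => ((b.1, Sum.inl b.2) : Idx (fine Lc M') (Fib 3)))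
          (fun b : ↥(pbox (fine Lc M')) × Fin (3 + 1) => ((b.1, Sum.inl b.2) : Idx (fine Lc M') (Fib 3)))))
    (H'₁f : V → Matrix (↥(pbox (fine Lc M')) × Fin (3 + 1)) (↥(pbox (fine Lc M')) × Fin (3 + 1)) ℝ)
    (hH'₁f : ∀ v, H'₁f v = ((-2 : ℝ) * (((Lc : ℝ) ^ (3 + 1) * stepScale 3 Lc 0)⁻¹)) • (∑ b : ↥(pbox (fine Lc M')) × Fin (3 + 1),
        ((hv v) b + ∑ s : ↥(pbox (fine Lc M')), tgrad (fine Lc M') (b.1, Sum.inl b.2) s * (lv v) s) •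
          (perF (fine Lc M') (dper (fine Lc M') (wilsonA 3 b.2 (b.1 : Site (3 + 1))))).submatrix
          (fun b : ↥(pbox (fine Lc M')) × Fin (3 + 1) => ((b.1, Sum.inl b.2) : Idx (fine Lc M') (Fib 3)))
          (fun b : ↥(pbox (fine Lc M')) × Fin (3 + 1) => ((b.1, Sum.inl b.2) : Idx (fine Lc M') (Fib 3))))
      + ∑ b : ↥(pbox (fine Lc M')) × Fin (3 + 1), ((hv v) b + ∑ s : ↥(pbox (fine Lc M')), tgrad (fine Lc M') (b.1, Sum.inl b.2) s * (lv v) s) •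
        (w • (perF (fine Lc M') (dper (fine Lc M')
            (SLam Lc (lamCoeffOf (KInv (N := Lc) (d := 3)) Lc) (symHessFFAt (ctr (3 + 1) Lc) Lc) b.2 (b.1 : Site (3 + 1))))).submatrix
          (fun b : ↥(pbox (fine Lc M')) × Fin (3 + 1) => ((b.1, Sum.inl b.2) : Idx (fine Lc M') (Fib 3)))
          (fun b : ↥(pbox (fine Lc M')) × Fin (3 + 1) => ((b.1, Sum.inl b.2) : Idx (fine Lc M') (Fib 3)))))
    (H₂f : V → V → Matrix (↥(pbox (fine Lc M')) × Fin (3 + 1)) (↥(pbox (fine Lc M')) × Fin (3 + 1)) ℝ)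
    (hH₂f : ∀ v v', H₂f v v' = ((-2 : ℝ) * (((Lc : ℝ) ^ (3 + 1) * stepScale 3 Lc 0)⁻¹)) ^ 2 •
        (∑ b : ↥(pbox (fine Lc M')) × Fin (3 + 1), ∑ b' : ↥(pbox (fine Lc M')) × Fin (3 + 1), ((hv v) b * (hv v') b') •
          (perF (fine Lc M') (dper (fine Lc M') (W b'.2 (b'.1 : Site (3 + 1)) b.2 (b.1 : Site (3 + 1))))).submatrix
            (fun c : ↥(pbox (fine Lc M')) × Fin (3 + 1) => ((c.1, Sum.inl c.2) : Idx (fine Lc M') (Fib 3)))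
            (fun c : ↥(pbox (fine Lc M')) × Fin (3 + 1) => ((c.1, Sum.inl c.2) : Idx (fine Lc M') (Fib 3)))))
    (H'₂f : V → V → Matrix (↥(pbox (fine Lc M')) × Fin (3 + 1)) (↥(pbox (fine Lc M')) × Fin (3 + 1)) ℝ)
    (hH'₂f : ∀ v v', H'₂f v v' = ((-2 : ℝ) * (((Lc : ℝ) ^ (3 + 1) * stepScale 3 Lc 0)⁻¹)) ^ 2 •
        (∑ b : ↥(pbox (fine Lc M')) × Fin (3 + 1), ∑ b' : ↥(pbox (fine Lc M')) × Fin (3 + 1),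
          (((hv v) b + ∑ s : ↥(pbox (fine Lc M')), tgrad (fine Lc M') (b.1, Sum.inl b.2) s * (lv v) s)
            * ((hv v') b' + ∑ s : ↥(pbox (fine Lc M')), tgrad (fine Lc M') (b'.1, Sum.inl b'.2) s * (lv v') s)) •
          (perF (fine Lc M') (dper (fine Lc M') (W b'.2 (b'.1 : Site (3 + 1)) b.2 (b.1 : Site (3 + 1))))).submatrix
            (fun c : ↥(pbox (fine Lc M')) × Fin (3 + 1) => ((c.1, Sum.inl c.2) : Idx (fine Lc M') (Fib 3)))
            (fun c : ↥(pbox (fine Lc M')) × Fin (3 + 1) => ((c.1, Sum.inl c.2) : Idx (fine Lc M') (Fib 3))))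
      + ((-2 : ℝ) * (((Lc : ℝ) ^ (3 + 1) * stepScale 3 Lc 0)⁻¹)) •
        ((∑ b : ↥(pbox (fine Lc M')) × Fin (3 + 1), (hv v) b •
            (w • (perF (fine Lc M') (dper (fine Lc M')
              (SLam Lc (lamCoeffOf (KInv (N := Lc) (d := 3)) Lc) (symHessFFAt (ctr (3 + 1) Lc) Lc) b.2 (b.1 : Site (3 + 1))))).submatrix
            (fun b : ↥(pbox (fine Lc M')) × Fin (3 + 1) => ((b.1, Sum.inl b.2) : Idx (fine Lc M') (Fib 3)))
            (fun b : ↥(pbox (fine Lc M')) × Fin (3 + 1) => ((b.1, Sum.inl b.2) : Idx (fine Lc M') (Fib 3)))))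
          * Matrix.diagonal (fun b : ↥(pbox (fine Lc M')) × Fin (3 + 1) => (lv v') b.1)
        - Matrix.diagonal (fun b : ↥(pbox (fine Lc M')) × Fin (3 + 1) => (lv v) b.1)
          * (∑ b : ↥(pbox (fine Lc M')) × Fin (3 + 1), (hv v') b •
            (w • (perF (fine Lc M') (dper (fine Lc M')
              (SLam Lc (lamCoeffOf (KInv (N := Lc) (d := 3)) Lc) (symHessFFAt (ctr (3 + 1) Lc) Lc) b.2 (b.1 : Site (3 + 1))))).submatrix
            (fun b : ↥(pbox (fine Lc M')) × Fin (3 + 1) => ((b.1, Sum.inl b.2) : Idx (fine Lc M') (Fib 3)))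
            (fun b : ↥(pbox (fine Lc M')) × Fin (3 + 1) => ((b.1, Sum.inl b.2) : Idx (fine Lc M') (Fib 3)))))))
    (𝔔'₁f : V → Matrix κ (↥(pbox (fine Lc M')) × Fin (3 + 1)) ℝ)
    (h𝔔'₁f : ∀ v, 𝔔'₁f v = Q₂₁ (fun b => (hv v) b + ∑ s : ↥(pbox (fine Lc M')), tgrad (fine Lc M') (b.1, Sum.inl b.2) s * (lv v) s) * Q₁₀
        + Q₂₀ * Q₁₁ (fun b => (hv v) b + ∑ s : ↥(pbox (fine Lc M')), tgrad (fine Lc M') (b.1, Sum.inl b.2) s * (lv v) s))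
    -- the order-2 AVERAGING bindings DISPLAYED as bilinear maps (R-FP-63 (iv)): the one-shot naming `𝔔′₂` on the diagonal = I-7's `h𝔔'₂` left side
    (NY₂f : V → V → Matrix κ (↥(pbox (fine Lc M')) × Fin (3 + 1)) ℝ)
    (hNY₂d : ∀ v, NY₂f v v = Q₂₂ (fun b => (hv v) b + ∑ s : ↥(pbox (fine Lc M')), tgrad (fine Lc M') (b.1, Sum.inl b.2) s * (lv v) s) (fun b => (hv v) b + ∑ s : ↥(pbox (fine Lc M')), tgrad (fine Lc M') (b.1, Sum.inl b.2) s * (lv v) s) * Q₁₀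
        + Q₂₁ (fun b => (hv v) b + ∑ s : ↥(pbox (fine Lc M')), tgrad (fine Lc M') (b.1, Sum.inl b.2) s * (lv v) s) * Q₁₁ (fun b => (hv v) b + ∑ s : ↥(pbox (fine Lc M')), tgrad (fine Lc M') (b.1, Sum.inl b.2) s * (lv v) s)
        + (Q₂₁ (fun b => (hv v) b + ∑ s : ↥(pbox (fine Lc M')), tgrad (fine Lc M') (b.1, Sum.inl b.2) s * (lv v) s) * Q₁₁ (fun b => (hv v) b + ∑ s : ↥(pbox (fine Lc M')), tgrad (fine Lc M') (b.1, Sum.inl b.2) s * (lv v) s)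
          + Q₂₀ * Q₁₂ (fun b => (hv v) b + ∑ s : ↥(pbox (fine Lc M')), tgrad (fine Lc M') (b.1, Sum.inl b.2) s * (lv v) s) (fun b => (hv v) b + ∑ s : ↥(pbox (fine Lc M')), tgrad (fine Lc M') (b.1, Sum.inl b.2) s * (lv v) s)))
    (hNY₂l : ∀ (c : ℝ) (x y z : V), NY₂f (c • x + y) z = c • NY₂f x z + NY₂f y z)
    (hNY₂r : ∀ (c : ℝ) (x y z : V), NY₂f x (c • y + z) = c • NY₂f x y + NY₂f x z)
    (hQ₂₂l : ∀ (c : ℝ) (x y z : ↥(pbox (fine Lc M')) × Fin (3 + 1) → ℝ), Q₂₂ (c • x + y) z = c • Q₂₂ x z + Q₂₂ y z)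
    (hQ₂₂r : ∀ (c : ℝ) (x y z : ↥(pbox (fine Lc M')) × Fin (3 + 1) → ℝ), Q₂₂ x (c • y + z) = c • Q₂₂ x y + Q₂₂ x z)
    -- THE COMPANION PAIR (R-FP-59 ∕ I-7): the (Δ1) order-1 coarse companion `Λ₁` as a LINEAR function of the direction, ANTISYMMETRIC along every
    -- direction (I-7's graded parity `hΛ₁t`); the order-2 direction companion `N₂c` DISPLAYED as a bilinear map whose DIAGONAL is I-7's (Δ2) letter
    -- `C₁ = −(Q₁₁h)ᵀΛ₁Q₁₀ − (Q₁₁h)ᵀΛ₁Q₁₀ + Q₁₀ᵀΛ₁Q₁₁h + Q₁₀ᵀΛ₁Q₁₁h` plus the two graded commutators `(Q₁₀ᵀΛ₁Q₁₀)X − Xᵀ(Q₁₀ᵀΛ₁Q₁₀)` (I-7's conclusion, `X` the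
    -- pinned diagonal generator); the order-2 coarse companion `Λ₂` rides in the FREE symmetric coarse family `EC` (below), the free `G` in `EF`
    (Λ₁f : V → Matrix (↥(pbox M') × Fin (3 + 1)) (↥(pbox M') × Fin (3 + 1)) ℝ)
    (hΛ₁l : ∀ (c : ℝ) (x y : V), Λ₁f (c • x + y) = c • Λ₁f x + Λ₁f y) (hΛ₁t : ∀ v : V, (Λ₁f v)ᵀ = -Λ₁f v)
    (N₂cf : V → V → Matrix (↥(pbox (fine Lc M')) × Fin (3 + 1)) (↥(pbox (fine Lc M')) × Fin (3 + 1)) ℝ)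
    (hN₂cd : ∀ v : V, N₂cf v v = ((-((Q₁₁ (hv v))ᵀ * (Λ₁f v) * Q₁₀) - (Q₁₁ (hv v))ᵀ * (Λ₁f v) * Q₁₀ + Q₁₀ᵀ * (Λ₁f v) * Q₁₁ (hv v) + Q₁₀ᵀ * (Λ₁f v) * Q₁₁ (hv v)) + ((Q₁₀ᵀ * (Λ₁f v) * Q₁₀) * (-((((Lc : ℝ) ^ (3 + 1) * stepScale 3 Lc 0)⁻¹) • Matrix.diagonal (fun b : ↥(pbox (fine Lc M')) × Fin (3 + 1) => (lv v) b.1))) + -((-((((Lc : ℝ) ^ (3 + 1) * stepScale 3 Lc 0)⁻¹) • Matrix.diagonal (fun b : ↥(pbox (fine Lc M')) × Fin (3 + 1) => (lv v) b.1)))ᵀ * (Q₁₀ᵀ * (Λ₁f v) * Q₁₀))) + ((Q₁₀ᵀ * (Λ₁f v) * Q₁₀) * (-((((Lc : ℝ) ^ (3 + 1) * stepScale 3 Lc 0)⁻¹) • Matrix.diagonal (fun b : ↥(pbox (fine Lc M')) × Fin (3 + 1) => (lv v) b.1))) + -((-((((Lc : ℝ) ^ (3 + 1) * stepScale 3 Lc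 0)⁻¹) • Matrix.diagonal (fun b : ↥(pbox (fine Lc M')) × Fin (3 + 1) => (lv v) b.1)))ᵀ * (Q₁₀ᵀ * (Λ₁f v) * Q₁₀)))))
    (hN₂cl : ∀ (c : ℝ) (x y z : V), N₂cf (c • x + y) z = c • N₂cf x z + N₂cf y z)
    (hN₂cr : ∀ (c : ℝ) (x y z : V), N₂cf x (c • y + z) = c • N₂cf x y + N₂cf x z)
    -- I-7's displayed ROWS `hdead a1 a2` (total jets), for EVERY direction (free witnesses as functions of the direction and of the free pair)
    (Y₁f : V → Matrix κ (Res (ctr (3 + 1) Lc) Lc M' ⊕ Res (ctr (3 + 1) Lc) Lc (fine Lc M')) ℝ)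
    (Y₂f : V → Matrix (↥(pbox (fine Lc M')) × Fin (3 + 1)) (↥(pbox (fine Lc M')) × Fin (3 + 1)) ℝ → Matrix (↥(pbox M') × Fin (3 + 1)) (↥(pbox M') × Fin (3 + 1)) ℝ → Matrix κ (Res (ctr (3 + 1) Lc) Lc M' ⊕ Res (ctr (3 + 1) Lc) Lc (fine Lc M')) ℝ)
    (hdead : ∀ v : V, ∀ (a : ↥(pbox M') × Fin (3 + 1)) (x : Res (ctr (3 + 1) Lc) Lc M'),
      combBondT (ctr (3 + 1) Lc) Lc M' x = ((a.1, Sum.inl a.2) : Idx M' (Fib 3)) → ∑ b : ↥(pbox (fine Lc M')) × Fin (3 + 1), Q₁₀ a b * (hv v) b = 0)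
    (a1 : ∀ v : V, ((H₁f v) + (Q₁₀ᵀ * (Λ₁f v) * Q₁₀)) * fromCols D₂ D₁ + H₀ * (W₁f v) = 𝔔₀ᵀ * (Y₁f v))
    (a2 : ∀ (v : V) (EF' : Matrix (↥(pbox (fine Lc M')) × Fin (3 + 1)) (↥(pbox (fine Lc M')) × Fin (3 + 1)) ℝ) (EC' : Matrix (↥(pbox M') × Fin (3 + 1)) (↥(pbox M') × Fin (3 + 1)) ℝ), ((H₂f v v + EF') + (-((Q₁₁ (hv v))ᵀ * (Λ₁f v) * Q₁₀) - (Q₁₁ (hv v))ᵀ * (Λ₁f v) * Q₁₀ + Q₁₀ᵀ * EC' * Q₁₀ + Q₁₀ᵀ * (Λ₁f v) * Q₁₁ (hv v) + Q₁₀ᵀ * (Λ₁f v) * Q₁₁ (hv v))) * fromCols D₂ D₁ + (2 : ℝ) • (((H₁f v) + (Q₁₀ᵀ * (Λ₁f v) * Q₁₀)) * (W₁f v)) + H₀ * (W₂f v)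
      = -((2 : ℝ) • ((Q₂₁ (hv v) * Q₁₀ + Q₂₀ * Q₁₁ (hv v))ᵀ * (Y₁f v))) + 𝔔₀ᵀ * (Y₂f v EF' EC'))
    -- right inverses of the three base systems (leaf-05's `RelInvPeriodised*` letters supply them at the record)
    {XN : Matrix ((↥(pbox (fine Lc M')) × Fin (3 + 1)) ⊕ (κ ⊕ (Res (ctr (3 + 1) Lc) Lc M' ⊕ Res (ctr (3 + 1) Lc) Lc (fine Lc M')))) ((↥(pbox (fine Lc M')) × Fin (3 + 1)) ⊕ (κ ⊕ (Res (ctr (3 + 1) Lc) Lc M' ⊕ Res (ctr (3 + 1) Lc) Lc (fine Lc M')))) ℝ} (hXN : kkt H₀ (fromRows 𝔔₀ P) * XN = 1)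
    {σ : Type*} [Fintype σ] [DecidableEq σ] (d : σ → V) (EF : σ → σ → Matrix (↥(pbox (fine Lc M')) × Fin (3 + 1)) (↥(pbox (fine Lc M')) × Fin (3 + 1)) ℝ) (hEFs : ∀ k l, EF k l = EF l k) (hEFt : ∀ k l, (EF k l)ᵀ = EF l k)
    (EC : σ → σ → Matrix (↥(pbox M') × Fin (3 + 1)) (↥(pbox M') × Fin (3 + 1)) ℝ) (hECs : ∀ k l, EC k l = EC l k) (hECt : ∀ k l, (EC k l)ᵀ = EC l k) (k l : σ)
    -- (S3-1) N — the ONE-SHOT LEG PRESENTED (an2's (C1) one-shot chart `A_N` under the torus rules + leaf-05 `packedLeg_oneShot_eq`): DISPLAYED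
    (ρN : Fin (3 + 1) → ℤ) (LNc : ℕ) (fN : κ → Idx (fine Lc M') (Fib 3)) (hfN : Function.Injective fN)
    (hmN : ∀ a : κ, ∃ m : Fin (3 + 1), (fN a).2 = Sum.inr m)
    (hcN : ∀ (s : ↥(pbox (fine Lc M'))) (m : Fin (3 + 1)), ((s, Sum.inr m) : Idx (fine Lc M') (Fib 3)) ∈ Set.range fN ↔ Torus.proj LNc (s : Site (3 + 1)) = 0)
    {AN : MKer (3 + 1) (Fib 3)} (hEAN : perF (fine Lc M') (axEc ρN LNc) * perF (fine Lc M') AN = perF (fine Lc M') AN)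
    (hAEN : perF (fine Lc M') AN * perF (fine Lc M') (axEc ρN LNc) = perF (fine Lc M') AN)
    (hLN : XN.submatrix (Sum.map id Sum.inl) (Sum.map id Sum.inl) = fromBlocks
      (Matrix.of fun (b b' : ↥(pbox (fine Lc M')) × Fin (3 + 1)) =>
        axEc ρN LNc (b.1 : Site (3 + 1)) (b.1 : Site (3 + 1)) (Sum.inl b.2) (Sum.inl b.2)
          * (axEc ρN LNc (b'.1 : Site (3 + 1)) (b'.1 : Site (3 + 1)) (Sum.inl b'.2) (Sum.inl b'.2) * perF (fine Lc M') AN (b.1, Sum.inl b.2) (b'.1, Sum.inl b'.2)))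
      (Matrix.of fun (b : ↥(pbox (fine Lc M')) × Fin (3 + 1)) (a : κ) =>
        axEc ρN LNc (b.1 : Site (3 + 1)) (b.1 : Site (3 + 1)) (Sum.inl b.2) (Sum.inl b.2) * perF (fine Lc M') AN (b.1, Sum.inl b.2) (fN a))
      (-Matrix.of fun (a : κ) (b : ↥(pbox (fine Lc M')) × Fin (3 + 1)) =>
        axEc ρN LNc (b.1 : Site (3 + 1)) (b.1 : Site (3 + 1)) (Sum.inl b.2) (Sum.inl b.2) * perF (fine Lc M') AN (fN a) (b.1, Sum.inl b.2))
      (-((perF (fine Lc M') AN).submatrix fN fN)))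
    -- (S3-2) N — the one-shot jets NAMED as full-index torus matrices (an2's namings): parities + block bindings DISPLAYED
    (VN VN' WN : Matrix (Idx (fine Lc M') (Fib 3)) (Idx (fine Lc M') (Fib 3)) ℝ)
    (hVNm : ∀ a a' : κ, VN (fN a) (fN a') = 0)
    (hVNt : ∀ (b : (↥(pbox (fine Lc M')) × Fin (3 + 1))) (a : κ), VN (b.1, Sum.inl b.2) (fN a) = VN (fN a) (b.1, Sum.inl b.2))
    (hVN'm : ∀ a a' : κ, VN' (fN a) (fN a') = 0)
    (hVN't : ∀ (b : (↥(pbox (fine Lc M')) × Fin (3 + 1))) (a : κ), VN' (b.1, Sum.inl b.2) (fN a) = VN' (fN a) (b.1, Sum.inl b.2))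
    (hWNm : ∀ a a' : κ, WN (fN a) (fN a') = 0)
    (hWNt : ∀ (b : (↥(pbox (fine Lc M')) × Fin (3 + 1))) (a : κ), WN (b.1, Sum.inl b.2) (fN a) = -WN (fN a) (b.1, Sum.inl b.2))
    (hHN₁ : H'₁f (d k) + Q₁₀ᵀ * Λ₁f (d k) * Q₁₀ = VN.submatrix (fun b : ↥(pbox (fine Lc M')) × Fin (3 + 1) => ((b.1, Sum.inl b.2) : Idx (fine Lc M') (Fib 3))) (fun b : ↥(pbox (fine Lc M')) × Fin (3 + 1) => ((b.1, Sum.inl b.2) : Idx (fine Lc M') (Fib 3))))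
    (hQN₁ : 𝔔'₁f (d k) = VN.submatrix fN (fun b : ↥(pbox (fine Lc M')) × Fin (3 + 1) => ((b.1, Sum.inl b.2) : Idx (fine Lc M') (Fib 3))))
    (hHN₁' : H'₁f (d l) + Q₁₀ᵀ * Λ₁f (d l) * Q₁₀ = VN'.submatrix (fun b : ↥(pbox (fine Lc M')) × Fin (3 + 1) => ((b.1, Sum.inl b.2) : Idx (fine Lc M') (Fib 3))) (fun b : ↥(pbox (fine Lc M')) × Fin (3 + 1) => ((b.1, Sum.inl b.2) : Idx (fine Lc M') (Fib 3))))
    (hQN₁' : 𝔔'₁f (d l) = VN'.submatrix fN (fun b : ↥(pbox (fine Lc M')) × Fin (3 + 1) => ((b.1, Sum.inl b.2) : Idx (fine Lc M') (Fib 3))))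
    (hHN₂ : (1 / 2 : ℝ) • ((H'₂f (d k) (d l) + N₂cf (d k) (d l)) + (H'₂f (d l) (d k) + N₂cf (d l) (d k))) + (EF k l + Q₁₀ᵀ * EC k l * Q₁₀) = WN.submatrix (fun b : ↥(pbox (fine Lc M')) × Fin (3 + 1) => ((b.1, Sum.inl b.2) : Idx (fine Lc M') (Fib 3))) (fun b : ↥(pbox (fine Lc M')) × Fin (3 + 1) => ((b.1, Sum.inl b.2) : Idx (fine Lc M') (Fib 3))))
    (hQN₂ : (1 / 2 : ℝ) • (NY₂f (d k) (d l) + NY₂f (d l) (d k)) = WN.submatrix fN (fun b : ↥(pbox (fine Lc M')) × Fin (3 + 1) => ((b.1, Sum.inl b.2) : Idx (fine Lc M') (Fib 3))))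
    -- (S3-2) F — the fine jets NAMED (an2 2c-iii ∕ 2d + #38 ∕ #38c at `hv (d k) := Â(·,k)`): parities + block bindings DISPLAYED; the LEG is DISCHARGED inside
    (VF VF' WF : Matrix (Idx (fine Lc M') (Fib 3)) (Idx (fine Lc M') (Fib 3)) ℝ)
    (hVFm : ∀ a a' : (↥(pbox M') × Fin (3 + 1)), VF ((fun a : ↥(pbox M') × Fin (3 + 1) => ((coarsePt M' Lc a.1, Sum.inr a.2) : Idx (fine Lc M') (Fib 3))) a) ((fun a : ↥(pbox M') × Fin (3 + 1) => ((coarsePt M' Lc a.1, Sum.inr a.2) : Idx (fine Lc M') (Fib 3))) a') = 0)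
    (hVFt : ∀ (b : (↥(pbox (fine Lc M')) × Fin (3 + 1))) (a : (↥(pbox M') × Fin (3 + 1))), VF (b.1, Sum.inl b.2) ((fun a : ↥(pbox M') × Fin (3 + 1) => ((coarsePt M' Lc a.1, Sum.inr a.2) : Idx (fine Lc M') (Fib 3))) a) = VF ((fun a : ↥(pbox M') × Fin (3 + 1) => ((coarsePt M' Lc a.1, Sum.inr a.2) : Idx (fine Lc M') (Fib 3))) a) (b.1, Sum.inl b.2))
    (hVF'm : ∀ a a' : (↥(pbox M') × Fin (3 + 1)), VF' ((fun a : ↥(pbox M') × Fin (3 + 1) => ((coarsePt M' Lc a.1, Sum.inr a.2) : Idx (fine Lc M') (Fib 3))) a) ((fun a : ↥(pbox M') × Fin (3 + 1) => ((coarsePt M' Lc a.1, Sum.inr a.2) : Idx (fine Lc M') (Fib 3))) a') = 0)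
    (hVF't : ∀ (b : (↥(pbox (fine Lc M')) × Fin (3 + 1))) (a : (↥(pbox M') × Fin (3 + 1))), VF' (b.1, Sum.inl b.2) ((fun a : ↥(pbox M') × Fin (3 + 1) => ((coarsePt M' Lc a.1, Sum.inr a.2) : Idx (fine Lc M') (Fib 3))) a) = VF' ((fun a : ↥(pbox M') × Fin (3 + 1) => ((coarsePt M' Lc a.1, Sum.inr a.2) : Idx (fine Lc M') (Fib 3))) a) (b.1, Sum.inl b.2))
    (hWFm : ∀ a a' : (↥(pbox M') × Fin (3 + 1)), WF ((fun a : ↥(pbox M') × Fin (3 + 1) => ((coarsePt M' Lc a.1, Sum.inr a.2) : Idx (fine Lc M') (Fib 3))) a) ((fun a : ↥(pbox M') × Fin (3 + 1) => ((coarsePt M' Lc a.1, Sum.inr a.2) : Idx (fine Lc M') (Fib 3))) a') = 0)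
    (hWFt : ∀ (b : (↥(pbox (fine Lc M')) × Fin (3 + 1))) (a : (↥(pbox M') × Fin (3 + 1))), WF (b.1, Sum.inl b.2) ((fun a : ↥(pbox M') × Fin (3 + 1) => ((coarsePt M' Lc a.1, Sum.inr a.2) : Idx (fine Lc M') (Fib 3))) a) = -WF ((fun a : ↥(pbox M') × Fin (3 + 1) => ((coarsePt M' Lc a.1, Sum.inr a.2) : Idx (fine Lc M') (Fib 3))) a) (b.1, Sum.inl b.2))
    (hHF₁ : H₁f (d k) = VF.submatrix (fun b : ↥(pbox (fine Lc M')) × Fin (3 + 1) => ((b.1, Sum.inl b.2) : Idx (fine Lc M') (Fib 3))) (fun b : ↥(pbox (fine Lc M')) × Fin (3 + 1) => ((b.1, Sum.inl b.2) : Idx (fine Lc M') (Fib 3))))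
    (hQF₁ : Q₁₁ (hv (d k)) = VF.submatrix (fun a : ↥(pbox M') × Fin (3 + 1) => ((coarsePt M' Lc a.1, Sum.inr a.2) : Idx (fine Lc M') (Fib 3))) (fun b : ↥(pbox (fine Lc M')) × Fin (3 + 1) => ((b.1, Sum.inl b.2) : Idx (fine Lc M') (Fib 3))))
    (hHF₁' : H₁f (d l) = VF'.submatrix (fun b : ↥(pbox (fine Lc M')) × Fin (3 + 1) => ((b.1, Sum.inl b.2) : Idx (fine Lc M') (Fib 3))) (fun b : ↥(pbox (fine Lc M')) × Fin (3 + 1) => ((b.1, Sum.inl b.2) : Idx (fine Lc M') (Fib 3))))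
    (hQF₁' : Q₁₁ (hv (d l)) = VF'.submatrix (fun a : ↥(pbox M') × Fin (3 + 1) => ((coarsePt M' Lc a.1, Sum.inr a.2) : Idx (fine Lc M') (Fib 3))) (fun b : ↥(pbox (fine Lc M')) × Fin (3 + 1) => ((b.1, Sum.inl b.2) : Idx (fine Lc M') (Fib 3))))
    (hHF₂ : (1 / 2 : ℝ) • (H₂f (d k) (d l) + H₂f (d l) (d k)) + EF k l = WF.submatrix (fun b : ↥(pbox (fine Lc M')) × Fin (3 + 1) => ((b.1, Sum.inl b.2) : Idx (fine Lc M') (Fib 3))) (fun b : ↥(pbox (fine Lc M')) × Fin (3 + 1) => ((b.1, Sum.inl b.2) : Idx (fine Lc M') (Fib 3))))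
    (hQF₂ : (1 / 2 : ℝ) • (Q₁₂ (hv (d k)) (hv (d l)) + Q₁₂ (hv (d l)) (hv (d k))) = WF.submatrix (fun a : ↥(pbox M') × Fin (3 + 1) => ((coarsePt M' Lc a.1, Sum.inr a.2) : Idx (fine Lc M') (Fib 3))) (fun b : ↥(pbox (fine Lc M')) × Fin (3 + 1) => ((b.1, Sum.inl b.2) : Idx (fine Lc M') (Fib 3))))
    -- (S3-2) G — the coarse jets NAMED (PART THREE), the H-blocks carrying the unit `wVH 3 Lc 1` of `hId` (the coarse form is `(wVH 3 Lc 1)⁻¹ • 𝕄₁|ff`,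
    -- leaf-05 `hId_comb`; #40a `KktUnitConjugation` moves the unit from the leg onto the blocks): parities + block bindings DISPLAYED; the LEG is DISCHARGED inside
    (VG VG' WG : Matrix (Idx M' (Fib 3)) (Idx M' (Fib 3)) ℝ)
    (hVGm : ∀ a a' : κ, VG ((fun a : κ => ((pμ' a, Sum.inr (mμ' a)) : Idx M' (Fib 3))) a) ((fun a : κ => ((pμ' a, Sum.inr (mμ' a)) : Idx M' (Fib 3))) a') = 0)
    (hVGt : ∀ (b : (↥(pbox M') × Fin (3 + 1))) (a : κ), VG (b.1, Sum.inl b.2) ((fun a : κ => ((pμ' a, Sum.inr (mμ' a)) : Idx M' (Fib 3))) a) = VG ((fun a : κ => ((pμ' a, Sum.inr (mμ' a)) : Idx M' (Fib 3))) a) (b.1, Sum.inl b.2))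
    (hVG'm : ∀ a a' : κ, VG' ((fun a : κ => ((pμ' a, Sum.inr (mμ' a)) : Idx M' (Fib 3))) a) ((fun a : κ => ((pμ' a, Sum.inr (mμ' a)) : Idx M' (Fib 3))) a') = 0)
    (hVG't : ∀ (b : (↥(pbox M') × Fin (3 + 1))) (a : κ), VG' (b.1, Sum.inl b.2) ((fun a : κ => ((pμ' a, Sum.inr (mμ' a)) : Idx M' (Fib 3))) a) = VG' ((fun a : κ => ((pμ' a, Sum.inr (mμ' a)) : Idx M' (Fib 3))) a) (b.1, Sum.inl b.2))
    (hWGm : ∀ a a' : κ, WG ((fun a : κ => ((pμ' a, Sum.inr (mμ' a)) : Idx M' (Fib 3))) a) ((fun a : κ => ((pμ' a, Sum.inr (mμ' a)) : Idx M' (Fib 3))) a') = 0)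
    (hWGt : ∀ (b : (↥(pbox M') × Fin (3 + 1))) (a : κ), WG (b.1, Sum.inl b.2) ((fun a : κ => ((pμ' a, Sum.inr (mμ' a)) : Idx M' (Fib 3))) a) = -WG ((fun a : κ => ((pμ' a, Sum.inr (mμ' a)) : Idx M' (Fib 3))) a) (b.1, Sum.inl b.2))
    (hHG₁ : (wVH 3 Lc 1) • ((((L * (H₁f (d k)) - S * (fromRows (Q₁₁ (hv (d k))) (0 : Matrix (Res (ctr (3 + 1) Lc) Lc (fine Lc M')) (↥(pbox (fine Lc M')) × Fin (3 + 1)) ℝ))) * I + L * (fromRows (Q₁₁ (hv (d k))) (0 : Matrix (Res (ctr (3 + 1) Lc) Lc (fine Lc M')) (↥(pbox (fine Lc M')) × Fin (3 + 1)) ℝ))ᵀ * S)).toBlocks₁₁ + Λ₁f (d k)) = VG.submatrix (fun b : ↥(pbox M') × Fin (3 + 1) => ((b.1, Sum.inl b.2) : Idx M' (Fib 3))) (fun b : ↥(pbox M') × Fin (3 + 1) => ((b.1, Sum.inl b.2) : Idx M' (Fib 3))))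
    (hQG₁ : Q₂₁ (hv (d k)) = VG.submatrix (fun a : κ => ((pμ' a, Sum.inr (mμ' a)) : Idx M' (Fib 3))) (fun b : ↥(pbox M') × Fin (3 + 1) => ((b.1, Sum.inl b.2) : Idx M' (Fib 3))))
    (hHG₁' : (wVH 3 Lc 1) • ((((L * (H₁f (d l)) - S * (fromRows (Q₁₁ (hv (d l))) (0 : Matrix (Res (ctr (3 + 1) Lc) Lc (fine Lc M')) (↥(pbox (fine Lc M')) × Fin (3 + 1)) ℝ))) * I + L * (fromRows (Q₁₁ (hv (d l))) (0 : Matrix (Res (ctr (3 + 1) Lc) Lc (fine Lc M')) (↥(pbox (fine Lc M')) × Fin (3 + 1)) ℝ))ᵀ * S)).toBlocks₁₁ + Λ₁f (d l)) = VG'.submatrix (fun b : ↥(pbox M') × Fin (3 + 1) => ((b.1, Sum.inl b.2) : Idx M' (Fib 3))) (fun b : ↥(pbox M') × Fin (3 + 1) => ((b.1, Sum.inl b.2) : Idx M' (Fib 3))))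
    (hQG₁' : Q₂₁ (hv (d l)) = VG'.submatrix (fun a : κ => ((pμ' a, Sum.inr (mμ' a)) : Idx M' (Fib 3))) (fun b : ↥(pbox M') × Fin (3 + 1) => ((b.1, Sum.inl b.2) : Idx M' (Fib 3))))
    (hHG₂ : (wVH 3 Lc 1) • ((1 / 2 : ℝ) • ((((((-((L * (H₁f (d k)) - S * (fromRows (Q₁₁ (hv (d k))) (0 : Matrix (Res (ctr (3 + 1) Lc) Lc (fine Lc M')) (↥(pbox (fine Lc M')) × Fin (3 + 1)) ℝ))) * Γ - L * (fromRows (Q₁₁ (hv (d k))) (0 : Matrix (Res (ctr (3 + 1) Lc) Lc (fine Lc M')) (↥(pbox (fine Lc M')) × Fin (3 + 1)) ℝ))ᵀ * L) * (H₁f (d l)) + L * (H₂f (d k) (d l)) - (((L * (H₁f (d k)) - S * (fromRows (Q₁₁ (hv (d k))) (0 : Matrix (Res (ctr (3 + 1) Lc) Lc (fine Lc M')) (↥(pbox (fine Lc M')) × Fin (3 + 1)) ℝ))) * I + L * (fromRows (Q₁₁ (hv (d k))) (0 : Matrix (Res (ctr (3 + 1) Lc) Lc (fine Lc M')) (↥(pbox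 (fine Lc M')) × Fin (3 + 1)) ℝ))ᵀ * S) * (fromRows (Q₁₁ (hv (d l))) (0 : Matrix (Res (ctr (3 + 1) Lc) Lc (fine Lc M')) (↥(pbox (fine Lc M')) × Fin (3 + 1)) ℝ)) + S * (fromRows (Q₁₂ (hv (d k)) (hv (d l))) (0 : Matrix (Res (ctr (3 + 1) Lc) Lc (fine Lc M')) (↥(pbox (fine Lc M')) × Fin (3 + 1)) ℝ)))) * I + (L * (H₁f (d k)) - S * (fromRows (Q₁₁ (hv (d k))) (0 : Matrix (Res (ctr (3 + 1) Lc) Lc (fine Lc M')) (↥(pbox (fine Lc M')) × Fin (3 + 1)) ℝ))) * (-((Γ * (H₁f (d l)) + I * (fromRows (Q₁₁ (hv (d l))) (0 : Matrix (Res (ctr (3 + 1) Lc) Lc (fine Lc M')) (↥(pbox (fine Lc M')) × Fin (3 + 1)) ℝ))) * I + Γ * (fromRows (Q₁₁ (hv (d l))) (0 : Matrix (Res (ctr (3 + 1) Lc) Lc (fine Lc M')) (↥(pbox (fine Lc M')) × Fin (3 + 1)) ℝ))ᵀ * S))) - ((-((L * (H₁f (d k)) - S * (fromRows (Q₁₁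 (hv (d k))) (0 : Matrix (Res (ctr (3 + 1) Lc) Lc (fine Lc M')) (↥(pbox (fine Lc M')) × Fin (3 + 1)) ℝ))) * Γ - L * (fromRows (Q₁₁ (hv (d k))) (0 : Matrix (Res (ctr (3 + 1) Lc) Lc (fine Lc M')) (↥(pbox (fine Lc M')) × Fin (3 + 1)) ℝ))ᵀ * L) * (-(fromRows (Q₁₁ (hv (d l))) (0 : Matrix (Res (ctr (3 + 1) Lc) Lc (fine Lc M')) (↥(pbox (fine Lc M')) × Fin (3 + 1)) ℝ))ᵀ) + L * (fromRows (Q₁₂ (hv (d k)) (hv (d l))) (0 : Matrix (Res (ctr (3 + 1) Lc) Lc (fine Lc M')) (↥(pbox (fine Lc M')) × Fin (3 + 1)) ℝ))ᵀ) * S + L * (-(fromRows (Q₁₁ (hv (d k))) (0 : Matrix (Res (ctr (3 + 1) Lc) Lc (fine Lc M')) (↥(pbox (fine Lc M')) × Fin (3 + 1)) ℝ))ᵀ) * ((L * (H₁f (d l)) - S * (fromRows (Q₁₁ (hv (d l))) (0 : Matrix (Res (ctr (3 + 1) Lc) Lc (fine Lc M')) (↥(pbox (fine Lc M')) × Fin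 (3 + 1)) ℝ))) * I + L * (fromRows (Q₁₁ (hv (d l))) (0 : Matrix (Res (ctr (3 + 1) Lc) Lc (fine Lc M')) (↥(pbox (fine Lc M')) × Fin (3 + 1)) ℝ))ᵀ * S)))).toBlocks₁₁ + (0 : Matrix (↥(pbox M') × Fin (3 + 1)) (↥(pbox M') × Fin (3 + 1)) ℝ)) + (((((-((L * (H₁f (d l)) - S * (fromRows (Q₁₁ (hv (d l))) (0 : Matrix (Res (ctr (3 + 1) Lc) Lc (fine Lc M')) (↥(pbox (fine Lc M')) × Fin (3 + 1)) ℝ))) * Γ - L * (fromRows (Q₁₁ (hv (d l))) (0 : Matrix (Res (ctr (3 + 1) Lc) Lc (fine Lc M')) (↥(pbox (fine Lc M')) × Fin (3 + 1)) ℝ))ᵀ * L) * (H₁f (d k)) + L * (H₂f (d l) (d k)) - (((L * (H₁f (d l)) - S * (fromRows (Q₁₁ (hv (d l))) (0 : Matrix (Res (ctr (3 + 1) Lc) Lc (fine Lc M')) (↥(pbox (fine Lc M')) × Fin (3 + 1)) ℝ))) * I + L * (fromRows (Q₁₁ (hv (d l))) (0 : Matrix (Res (ctr (3 + 1) Lc)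 Lc (fine Lc M')) (↥(pbox (fine Lc M')) × Fin (3 + 1)) ℝ))ᵀ * S) * (fromRows (Q₁₁ (hv (d k))) (0 : Matrix (Res (ctr (3 + 1) Lc) Lc (fine Lc M')) (↥(pbox (fine Lc M')) × Fin (3 + 1)) ℝ)) + S * (fromRows (Q₁₂ (hv (d l)) (hv (d k))) (0 : Matrix (Res (ctr (3 + 1) Lc) Lc (fine Lc M')) (↥(pbox (fine Lc M')) × Fin (3 + 1)) ℝ)))) * I + (L * (H₁f (d l)) - S * (fromRows (Q₁₁ (hv (d l))) (0 : Matrix (Res (ctr (3 + 1) Lc) Lc (fine Lc M')) (↥(pbox (fine Lc M')) × Fin (3 + 1)) ℝ))) * (-((Γ * (H₁f (d k)) + I * (fromRows (Q₁₁ (hv (d k))) (0 : Matrix (Res (ctr (3 + 1) Lc) Lc (fine Lc M')) (↥(pbox (fine Lc M')) × Fin (3 + 1)) ℝ))) * I + Γ * (fromRows (Q₁₁ (hv (d k))) (0 : Matrix (Res (ctr (3 + 1) Lc) Lc (fine Lc M')) (↥(pbox (fine Lc M')) × Fin (3 + 1)) ℝ))ᵀ * S))) - ((-((L * (H₁f (d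 l)) - S * (fromRows (Q₁₁ (hv (d l))) (0 : Matrix (Res (ctr (3 + 1) Lc) Lc (fine Lc M')) (↥(pbox (fine Lc M')) × Fin (3 + 1)) ℝ))) * Γ - L * (fromRows (Q₁₁ (hv (d l))) (0 : Matrix (Res (ctr (3 + 1) Lc) Lc (fine Lc M')) (↥(pbox (fine Lc M')) × Fin (3 + 1)) ℝ))ᵀ * L) * (-(fromRows (Q₁₁ (hv (d k))) (0 : Matrix (Res (ctr (3 + 1) Lc) Lc (fine Lc M')) (↥(pbox (fine Lc M')) × Fin (3 + 1)) ℝ))ᵀ) + L * (fromRows (Q₁₂ (hv (d l)) (hv (d k))) (0 : Matrix (Res (ctr (3 + 1) Lc) Lc (fine Lc M')) (↥(pbox (fine Lc M')) × Fin (3 + 1)) ℝ))ᵀ) * S + L * (-(fromRows (Q₁₁ (hv (d l))) (0 : Matrix (Res (ctr (3 + 1) Lc) Lc (fine Lc M')) (↥(pbox (fine Lc M')) × Fin (3 + 1)) ℝ))ᵀ) * ((L * (H₁f (d k)) - S * (fromRows (Q₁₁ (hv (d k))) (0 : Matrix (Res (ctr (3 + 1) Lc) Lc (fine Lc M')) (↥(pbox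 (fine Lc M')) × Fin (3 + 1)) ℝ))) * I + L * (fromRows (Q₁₁ (hv (d k))) (0 : Matrix (Res (ctr (3 + 1) Lc) Lc (fine Lc M')) (↥(pbox (fine Lc M')) × Fin (3 + 1)) ℝ))ᵀ * S)))).toBlocks₁₁ + (0 : Matrix (↥(pbox M') × Fin (3 + 1)) (↥(pbox M') × Fin (3 + 1)) ℝ))) + ((L * EF k l * I).toBlocks₁₁ + EC k l)) = WG.submatrix (fun b : ↥(pbox M') × Fin (3 + 1) => ((b.1, Sum.inl b.2) : Idx M' (Fib 3))) (fun b : ↥(pbox M') × Fin (3 + 1) => ((b.1, Sum.inl b.2) : Idx M' (Fib 3))))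
    (hQG₂ : (1 / 2 : ℝ) • (Q₂₂ (hv (d k)) (hv (d l)) + Q₂₂ (hv (d l)) (hv (d k))) = WG.submatrix (fun a : κ => ((pμ' a, Sum.inr (mμ' a)) : Idx M' (Fib 3))) (fun b : ↥(pbox M') × Fin (3 + 1) => ((b.1, Sum.inl b.2) : Idx M' (Fib 3)))) :
    hessT (perF (fine Lc M') AN) VN VN' WN
      = hessT (perF (fine Lc M') (GcombSh (d := 3) Lc 0)) VF VF' WF + hessT (perF M' (GcombSh (d := 3) Lc 1)) VG VG' WG := by
  -- the slot facts of the two comb slices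
  have hMf : ∀ i, Lc ∣ fine Lc M' i := dvd_fine M'
  have hfF : Function.Injective (fun a : ↥(pbox M') × Fin (3 + 1) => ((coarsePt M' Lc a.1, Sum.inr a.2) : Idx (fine Lc M') (Fib 3))) := coarseSlot_injective M'
  have hmF : ∀ a : (↥(pbox M') × Fin (3 + 1)), ∃ m : Fin (3 + 1), ((fun a : ↥(pbox M') × Fin (3 + 1) => ((coarsePt M' Lc a.1, Sum.inr a.2) : Idx (fine Lc M') (Fib 3))) a).2 = Sum.inr m := fun a => ⟨a.2, rfl⟩
  have hcF : ∀ (s : ↥(pbox (fine Lc M'))) (m : Fin (3 + 1)),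
      ((s, Sum.inr m) : Idx (fine Lc M') (Fib 3)) ∈ Set.range (fun a : ↥(pbox M') × Fin (3 + 1) => ((coarsePt M' Lc a.1, Sum.inr a.2) : Idx (fine Lc M') (Fib 3))) ↔ Torus.proj Lc (s : Site (3 + 1)) = 0 := coarseSlot_range M'
  have hmG : ∀ a : κ, ∃ m : Fin (3 + 1), ((fun a : κ => ((pμ' a, Sum.inr (mμ' a)) : Idx M' (Fib 3))) a).2 = Sum.inr m := fun a => ⟨mμ' a, rfl⟩
  have hw : (wVH 3 Lc 1) ≠ 0 := (wVH_pos (d := 3) (Nat.pos_of_ne_zero (NeZero.ne Lc)) 1).ne'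
  subst hH₀ hQ₁₀ hτ₁
  -- the coarse form of the G system IS the unit-scaled level-1 chart form (leaf-05 `hId_comb`)
  have hS₁₁ : S.toBlocks₁₁ = (wVH 3 Lc 1)⁻¹ • ((perF M' (bhKStepSh 3 Lc (Dsh Lc) 1)).submatrix (fun b : ↥(pbox M') × Fin (3 + 1) => ((b.1, Sum.inl b.2) : Idx M' (Fib 3))) (fun b : ↥(pbox M') × Fin (3 + 1) => ((b.1, Sum.inl b.2) : Idx M' (Fib 3)))) := by
    rw [← hS]; exact hId_comb M' 0
  -- the right inverses of record
  have hXF := kkt_mul_inv_comb (fine Lc M') hMf 0 (fun a : ↥(pbox M') × Fin (3 + 1) => ((coarsePt M' Lc a.1, Sum.inr a.2) : Idx (fine Lc M') (Fib 3))) hfF hmF hcF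
  have hX₁ := kkt_mul_inv_comb M' hM' 1 (fun a : κ => ((pμ' a, Sum.inr (mμ' a)) : Idx M' (Fib 3))) hfμ' hmG hcoarse'
  rw [← hQ₂₀, ← hτ₂] at hX₁
  have hLG := packedLeg_comb_eq M' hM' 1 (fun a : κ => ((pμ' a, Sum.inr (mμ' a)) : Idx M' (Fib 3))) hfμ' hmG hcoarse'
  rw [← hQ₂₀, ← hτ₂] at hLG
  have hXG : kkt S.toBlocks₁₁ (fromRows Q₂₀ τ₂) * (fromBlocks (1 : Matrix (↥(pbox M') × Fin (3 + 1)) (↥(pbox M') × Fin (3 + 1)) ℝ) 0 0 ((wVH 3 Lc 1)⁻¹ • (1 : Matrix (κ ⊕ Res (ctr (3 + 1) Lc) Lc M') (κ ⊕ Res (ctr (3 + 1) Lc) Lc M') ℝ))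
          * (kkt ((perF M' (bhKStepSh 3 Lc (Dsh Lc) 1)).submatrix (fun b : ↥(pbox M') × Fin (3 + 1) => ((b.1, Sum.inl b.2) : Idx M' (Fib 3))) (fun b : ↥(pbox M') × Fin (3 + 1) => ((b.1, Sum.inl b.2) : Idx M' (Fib 3)))) (fromRows Q₂₀ τ₂))⁻¹
          * fromBlocks ((wVH 3 Lc 1) • (1 : Matrix (↥(pbox M') × Fin (3 + 1)) (↥(pbox M') × Fin (3 + 1)) ℝ)) 0 0 (1 : Matrix (κ ⊕ Res (ctr (3 + 1) Lc) Lc M') (κ ⊕ Res (ctr (3 + 1) Lc) Lc M') ℝ)) = 1 := by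
    rw [hS₁₁]; exact kkt_inv_smul_mul_rightInverse (wVH 3 Lc 1) hw _ _ _ hX₁
  -- #37c at the chosen inverses
  have h37 := hessT_kernel_law_levelZero_companion M' (hv := hv) (lv := lv) (hhv := hhv) (hlv := hlv) (hM' := hM') (pμ' := pμ') (mμ' := mμ') (hfμ' := hfμ') (hcoarse' := hcoarse') (hτ₂ := hτ₂) (hD₁ := hD₁) (hD₂ := hD₂) (hDbar := hDbar) (hP := hP) (hQ₂₀ := hQ₂₀) (Q₁₁ := Q₁₁) (hQ₁₁ := hQ₁₁) (Q₂₁ := Q₂₁) (hQ₂₁ := hQ₂₁) (w := w) (N := N) (hN := hN) (hW := hW) (hW₁₂ := hW₁₂) (Q₁₂ := Q₁₂) (hQ₁₂ := hQ₁₂) (hW₂₂ := hW₂₂) (Q₂₂ := Q₂₂) (hQ₂₂ := hQ₂₂) (hΓ := hΓ) (hI := hI) (hL := hL) (hS := hS) (h𝔔₀ := h𝔔₀) (W₁f := W₁f) (hW₁f := hW₁f) (Db₁f := Db₁f) (hDb₁f := hDb₁f) (W₂f := W₂f) (hW₂f := hW₂f) (H₁f := H₁f) (hH₁f := hH₁f)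 (H'₁f := H'₁f) (hH'₁f := hH'₁f) (H₂f := H₂f) (hH₂f := hH₂f) (H'₂f := H'₂f) (hH'₂f := hH'₂f) (𝔔'₁f := 𝔔'₁f) (h𝔔'₁f := h𝔔'₁f) (NY₂f := NY₂f) (hNY₂d := hNY₂d) (hNY₂l := hNY₂l) (hNY₂r := hNY₂r) (hQ₂₂l := hQ₂₂l) (hQ₂₂r := hQ₂₂r) (Λ₁f := Λ₁f) (hΛ₁l := hΛ₁l) (hΛ₁t := hΛ₁t) (N₂cf := N₂cf) (hN₂cd := hN₂cd) (hN₂cl := hN₂cl) (hN₂cr := hN₂cr) (Y₁f := Y₁f) (Y₂f := Y₂f) (hdead := hdead) (a1 := a1) (a2 := a2) (hXN := hXN) (d := d) (EF := EF) (hEFs := hEFs) (hEFt := hEFt) (EC := EC) (hECs := hECs) (hECt := hECt) (k := k) (l := l)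
    (hH₀ := rfl) (hQ₁₀ := rfl) (hτ₁ := rfl) (hXF := hXF) (hXG := hXG)
  -- the legs: F by leaf-05's level-0 comb word; G by the level-1 comb word after the unit transfer (#40a)
  rw [packedLeg_comb_eq (fine Lc M') hMf 0 (fun a : ↥(pbox M') × Fin (3 + 1) => ((coarsePt M' Lc a.1, Sum.inr a.2) : Idx (fine Lc M') (Fib 3))) hfF hmF hcF, fromBlocks_one_units_eq_diagonal, fromBlocks_units_one_eq_diagonal,
    submatrix_diagonal_mul_mul_diagonal, sumElim_const_comp_map, sumElim_const_comp_map, hLG, hessT_unitConj (wVH 3 Lc 1) hw] at h37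
  -- ONE term of #39
  exact hessT_fullIndex_law_of_packed_law ρN LNc (fine Lc M') fN hfN hmN hcN hEAN hAEN _ hLN VN VN' WN hVNm hVNt hVN'm hVN't hWNm hWNt _ _ _ _ _ _
      hHN₁ hQN₁ hHN₁' hQN₁' hHN₂ hQN₂
    (ctr (3 + 1) Lc) Lc (fine Lc M') (fun a : ↥(pbox M') × Fin (3 + 1) => ((coarsePt M' Lc a.1, Sum.inr a.2) : Idx (fine Lc M') (Fib 3))) hfF hmF hcF (perF_rules_comb (fine Lc M') hMf 0).1 (perF_rules_comb (fine Lc M') hMf 0).2.1 _ rfl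
      VF VF' WF hVFm hVFt hVF'm hVF't hWFm hWFt _ _ _ _ _ _ hHF₁ hQF₁ hHF₁' hQF₁' hHF₂ hQF₂
    (ctr (3 + 1) Lc) Lc M' (fun a : κ => ((pμ' a, Sum.inr (mμ' a)) : Idx M' (Fib 3))) hfμ' hmG hcoarse' (perF_rules_comb M' hM' 1).1 (perF_rules_comb M' hM' 1).2.1 _ rfl
      VG VG' WG hVGm hVGt hVG'm hVG't hWGm hWGt _ _ _ _ _ _ hHG₁ hQG₁ hHG₁' hQG₁' hHG₂ hQG₂ h37

end Law

end Summit.QuantumFields.BalabanUV.Beta.FP.LevelZeroLawFullIndex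

end
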